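import Mathlib
import HarnessLib
import Literature.MathematicalPhysics.StatisticalMechanics.LennardJonesClusters

/-!
# CrystalliteDichotomy — the finite-`N` CUT-AND-PASTE LAW (shared lever «CutPaste / removal law» of the decomp-a2c cell)

Registered stub `stub_cutPasteLaw` of the line of the crux `CrystalliteCase` (route `CrystalliteDichotomy`,
stmt-AtomisticToContinuum-31811), proved with its registered signature: for a Lennard-Jones ground state
`x : Fin N → ℝ³` and any index set `A`,

  `∑_(a ∈ A) ∑_(b ≠ a) V(|x_a − x_b|) ≤ 2 E(#A) + ∑_(a ∈ A) ∑_(b ∉ A) max(0, −V(|x_a − x_b|))`.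

Proof (cut and paste, no limit needed): write `2𝓔(x) = D_A + D_Aᶜ + 2 I` (`sum_sum_eq_add_compl`).  For every
injective `z : Fin #A → ℝ³` replace the particles of `A` by a translate `z + c` of `z` so far away that all cross
distances are `≥ 1`, where `V_LJ ≤ 0`; the new configuration `w` is injective, so `𝓔(x) = E(N) ≤ 𝓔(w)`, and
`2𝓔(w) = 2𝓔(z) + D_Aᶜ + (cross ≤ 0)`.  Hence `D_A + 2I ≤ 2𝓔(z)` for all such `z`, so `D_A + 2I ≤ 2E(#A)`
(`le_ciInf`), and the claim follows from `−I ≤ ∑ max(0, −V)`.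
-/

namespace Summit.AtomisticToContinuum.Crystallization.Theorems.CrystalliteDichotomyCutPasteLaw

open Literature.MathematicalPhysics.StatisticalMechanics

variable {N : ℕ}

/-- Reindexing a sum over an index set `A ⊆ Fin N` along `A.equivFin`, for a function that agrees on `A` with
`z ∘ A.equivFin`. [folklore] -/
theorem sum_eq_sum_equivFin {α : Type*} (A : Finset (Fin N)) (z : Fin A.card → α) (zA : Fin N → α)
    (hzA : ∀ k (hk : k ∈ A), zA k = z (A.equivFin ⟨k, hk⟩)) (g : α → ℝ) :
    ∑ k ∈ A, g (zA k) = ∑ l, g (z l) := by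
  rw [← Finset.sum_coe_sort]
  exact Fintype.sum_equiv A.equivFin _ _ (fun k => by rw [hzA (k : Fin N) k.2])

/-- **The trial state.** For a Lennard-Jones ground state `x`, an index set `A` and ANY injective `#A`-point
configuration `z`: `D_A(x) + 2 I_A(x) ≤ 2 𝓔(z)` — replace `x|_A` by a far translate of `z` (cross distances `≥ 1`,
where `V_LJ ≤ 0`) and compare energies. [cite: BlancLewin2015, §1.2 (cut and paste behind (6))] -/
theorem pairSum_add_two_mul_cross_le {x : Fin N → EuclideanSpace ℝ (Fin 3)}
    (hx : IsGroundState lennardJones x) (A : Finset (Fin N)) (z : Fin A.card → EuclideanSpace ℝ (Fin 3))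
    (hz : Function.Injective z) :
    ∑ a ∈ A, ∑ b ∈ A, lennardJones (dist (x a) (x b)) +
        2 * ∑ a ∈ A, ∑ b ∈ Aᶜ, lennardJones (dist (x a) (x b)) ≤
      2 * interactionEnergy lennardJones z := by
  classical
  set R : ℝ := 1 + ∑ k, ‖x k‖ + ∑ j, ‖z j‖ with hR
  have hR0 : 0 ≤ R := by
    have h1 : 0 ≤ ∑ k, ‖x k‖ := Finset.sum_nonneg fun k _ => norm_nonneg (x k)
    have h2 : 0 ≤ ∑ j, ‖z j‖ := Finset.sum_nonneg fun j _ => norm_nonneg (z j)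
    linarith
  set c : EuclideanSpace ℝ (Fin 3) := EuclideanSpace.single (0 : Fin 3) R with hc
  have hcn : ‖c‖ = R := by simp [hc, abs_of_nonneg hR0]
  set zA : Fin N → EuclideanSpace ℝ (Fin 3) := fun k => if h : k ∈ A then z (A.equivFin ⟨k, h⟩) else 0 with hzA
  have hzA_mem : ∀ k (hk : k ∈ A), zA k = z (A.equivFin ⟨k, hk⟩) := fun k hk => by simp [hzA, hk]
  set w : Fin N → EuclideanSpace ℝ (Fin 3) := fun k => if k ∈ A then zA k + c else x k with hw
  have hwA : ∀ k ∈ A, w k = zA k + c := fun k hk => by simp [hw, hk]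
  have hwAc : ∀ k ∈ Aᶜ, w k = x k := fun k hk => by simp [hw, Finset.mem_compl.1 hk]
  -- all cross distances of the trial state are ≥ 1
  have hfar : ∀ i ∈ A, ∀ k, 1 ≤ dist (zA i + c) (x k) := by
    intro i hi k
    rw [hzA_mem i hi]
    set j := A.equivFin ⟨i, hi⟩
    have hxk : ‖x k‖ ≤ ∑ k', ‖x k'‖ :=
      Finset.single_le_sum (f := fun k' => ‖x k'‖) (fun _ _ => norm_nonneg _) (Finset.mem_univ k)
    have hzj : ‖z j‖ ≤ ∑ j', ‖z j'‖ :=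
      Finset.single_le_sum (f := fun j' => ‖z j'‖) (fun _ _ => norm_nonneg _) (Finset.mem_univ j)
    have h1 : ‖c‖ - ‖x k - z j‖ ≤ dist (z j + c) (x k) := by
      rw [dist_eq_norm]
      have e : z j + c - x k = c - (x k - z j) := by abel
      rw [e]
      exact norm_sub_norm_le c (x k - z j)
    have h2 : ‖x k - z j‖ ≤ ‖x k‖ + ‖z j‖ := norm_sub_le _ _
    linarith
  -- the trial state is injective
  have hw_inj : Function.Injective w := by
    intro i k hik
    by_cases hi : i ∈ A <;> by_cases hk : k ∈ A
    · rw [hwA i hi, hwA k hk, hzA_mem i hi, hzA_mem k hk] at hik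
      have h := A.equivFin.injective (hz (add_right_cancel hik))
      exact congrArg Subtype.val h
    · exfalso
      have h := hfar i hi k
      rw [← hwA i hi, ← hwAc k (Finset.mem_compl.2 hk), hik, dist_self] at h
      norm_num at h
    · exfalso
      have h := hfar k hk i
      rw [← hwA k hk, ← hwAc i (Finset.mem_compl.2 hi), hik, dist_self] at h
      norm_num at h
    · rw [hwAc i (Finset.mem_compl.2 hi), hwAc k (Finset.mem_compl.2 hk)] at hik
      exact hx.1 hik
  -- energy comparison and the double-sum decompositions
  have hE : interactionEnergy lennardJones x ≤ interactionEnergy lennardJones w := by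
    rw [hx.2]; exact groundStateEnergy_lennardJones_le hw_inj
  have h2x := two_mul_interactionEnergy_eq_sum_sum lennardJones lennardJones_zero x
  have h2w := two_mul_interactionEnergy_eq_sum_sum lennardJones lennardJones_zero w
  rw [sum_sum_eq_add_compl _ A] at h2x h2w
  have hAA : ∑ i ∈ A, ∑ k ∈ A, lennardJones (dist (w i) (w k)) = 2 * interactionEnergy lennardJones z := by
    rw [two_mul_interactionEnergy_eq_sum_sum lennardJones lennardJones_zero z]
    calc ∑ i ∈ A, ∑ k ∈ A, lennardJones (dist (w i) (w k))
        = ∑ i ∈ A, ∑ k ∈ A, lennardJones (dist (zA i) (zA k)) := by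
          refine Finset.sum_congr rfl fun i hi => Finset.sum_congr rfl fun k hk => ?_
          rw [hwA i hi, hwA k hk, dist_add_right]
      _ = ∑ i ∈ A, ∑ l, lennardJones (dist (zA i) (z l)) := by
          refine Finset.sum_congr rfl fun i _ => ?_
          exact sum_eq_sum_equivFin A z zA hzA_mem (fun p => lennardJones (dist (zA i) p))
      _ = ∑ j, ∑ l, lennardJones (dist (z j) (z l)) :=
          sum_eq_sum_equivFin A z zA hzA_mem (fun p => ∑ l, lennardJones (dist p (z l)))
  have hAcAc : ∑ i ∈ Aᶜ, ∑ k ∈ Aᶜ, lennardJones (dist (w i) (w k)) =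
      ∑ i ∈ Aᶜ, ∑ k ∈ Aᶜ, lennardJones (dist (x i) (x k)) :=
    Finset.sum_congr rfl fun i hi => Finset.sum_congr rfl fun k hk => by rw [hwAc i hi, hwAc k hk]
  have hcross1 : ∑ i ∈ A, ∑ k ∈ Aᶜ, lennardJones (dist (w i) (w k)) ≤ 0 :=
    Finset.sum_nonpos fun i hi => Finset.sum_nonpos fun k hk => by
      rw [hwA i hi, hwAc k hk]; exact lennardJones_nonpos (hfar i hi k)
  have hcross2 : ∑ i ∈ Aᶜ, ∑ k ∈ A, lennardJones (dist (w i) (w k)) ≤ 0 :=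
    Finset.sum_nonpos fun i hi => Finset.sum_nonpos fun k hk => by
      rw [hwAc i hi, hwA k hk, dist_comm]; exact lennardJones_nonpos (hfar k hk i)
  have hsym : ∑ i ∈ Aᶜ, ∑ k ∈ A, lennardJones (dist (x i) (x k)) =
      ∑ i ∈ A, ∑ k ∈ Aᶜ, lennardJones (dist (x i) (x k)) := by
    rw [Finset.sum_comm]
    exact Finset.sum_congr rfl fun i _ => Finset.sum_congr rfl fun k _ => by rw [dist_comm]
  linarith

/-- **`D_A + 2 I_A ≤ 2 E(#A)`** for a Lennard-Jones ground state: infimum of the trial-state bound over the injective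
`#A`-point configurations (`le_ciInf`, the index type being non-empty by `nonempty_injective_config`).
[cite: BlancLewin2015, §1.2] -/
theorem pairSum_add_two_mul_cross_le_groundStateEnergy {x : Fin N → EuclideanSpace ℝ (Fin 3)}
    (hx : IsGroundState lennardJones x) (A : Finset (Fin N)) :
    ∑ a ∈ A, ∑ b ∈ A, lennardJones (dist (x a) (x b)) +
        2 * ∑ a ∈ A, ∑ b ∈ Aᶜ, lennardJones (dist (x a) (x b)) ≤
      2 * groundStateEnergy lennardJones 3 A.card := by
  haveI := nonempty_injective_config (show 0 < 3 by norm_num) A.card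
  have h : (∑ a ∈ A, ∑ b ∈ A, lennardJones (dist (x a) (x b)) +
      2 * ∑ a ∈ A, ∑ b ∈ Aᶜ, lennardJones (dist (x a) (x b))) / 2 ≤
        groundStateEnergy lennardJones 3 A.card := by
    unfold groundStateEnergy
    exact le_ciInf fun z => by
      have := pairSum_add_two_mul_cross_le hx A z.1 z.2
      linarith
  linarith

/-- Registered stub `stub_cutPasteLaw` of the crux `CrystalliteCase` (route CrystalliteDichotomy,
stmt-AtomisticToContinuum-31811; skeleton `CrystalliteCase_line.lean`), with its registered signature: the
finite-`N` cut-and-paste law `∑_(a∈A) ∑_(b≠a) V ≤ 2E(#A) + ∑_(A×Aᶜ) max(0, −V)` for Lennard-Jones ground states.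
[cite: BlancLewin2015, §1.2] -/
theorem stub_cutPasteLaw : ∀ (N : ℕ) (x : Fin N → EuclideanSpace ℝ (Fin 3)), Literature.MathematicalPhysics.StatisticalMechanics.IsGroundState Literature.MathematicalPhysics.StatisticalMechanics.lennardJones x → ∀ A : Finset (Fin N), ∑ a ∈ A, ∑ b ∈ Finset.univ.erase a, Literature.MathematicalPhysics.StatisticalMechanics.lennardJones (dist (x a) (x b)) ≤ 2 * Literature.MathematicalPhysics.StatisticalMechanics.groundStateEnergy Literature.MathematicalPhysics.StatisticalMechanics.lennardJones 3 A.card + ∑ a ∈ A, ∑ b ∈ Aᶜ, max 0 (-(Literature.MathematicalPhysics.StatisticalMechanics.lennardJones (dist (x a) (x b)))) := by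
  intro N x hx A
  classical
  have h0 : ∀ a : Fin N, ∑ b ∈ Finset.univ.erase a, lennardJones (dist (x a) (x b)) =
      ∑ b, lennardJones (dist (x a) (x b)) := by
    intro a
    rw [Finset.sum_erase_eq_sub (Finset.mem_univ a), dist_self, lennardJones_zero, sub_zero]
  simp_rw [h0]
  have h1 : ∑ a ∈ A, ∑ b, lennardJones (dist (x a) (x b)) =
      ∑ a ∈ A, ∑ b ∈ A, lennardJones (dist (x a) (x b)) +
        ∑ a ∈ A, ∑ b ∈ Aᶜ, lennardJones (dist (x a) (x b)) := by
    rw [← Finset.sum_add_distrib]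
    exact Finset.sum_congr rfl fun a _ => (Finset.sum_add_sum_compl A _).symm
  rw [h1]
  have key := pairSum_add_two_mul_cross_le_groundStateEnergy hx A
  have h3 : -(∑ a ∈ A, ∑ b ∈ Aᶜ, lennardJones (dist (x a) (x b))) ≤
      ∑ a ∈ A, ∑ b ∈ Aᶜ, max 0 (-(lennardJones (dist (x a) (x b)))) := by
    rw [← Finset.sum_neg_distrib]
    refine Finset.sum_le_sum fun a _ => ?_
    rw [← Finset.sum_neg_distrib]
    exact Finset.sum_le_sum fun b _ => le_max_right _ _
  linarith

end Summit.AtomisticToContinuum.Crystallization.Theorems.CrystalliteDichotomyCutPasteLaw
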